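import Mathlib
import Summits.Ventures.PercRepro2.CoinKSureAD
import Summits.Ventures.PercRepro2.CoinChainMixLsm
import Summits.Ventures.PercRepro2.CoinChainWorld1
import Summits.Ventures.PercRepro2.CoinChainStar
import Summits.Ventures.PercRepro2.CoinChainMixedCentreChain

/-!
# The BERNSTEIN form of the AND-switch chain: the chain at every coin probability from two
coin-free inequalities (blind cell PercRepro2, night-2 g22; proofs/NIGHT2-DARC.md §62)

The chain functional `T(ρ) = T(R_ρ, G_ρ)` of §56 is a CUBIC in the coin probability `ρ`
(`R_ρ = (1−ρ)R⁰ + ρR¹`, `G_ρ = (1−ρ)G⁰ + ρG¹` by `chainMix_affine`; `T` is quadratic in the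
`R`-law and linear in the gate).  Writing `U(i,j,k) = ∑ Gᵏ (Rⁱ₀ x − Rⁱ₁)(Rʲ₀ y − Rʲ₂)` for the
gate `Gᵏ` centred at the `x`-mean of `Rⁱ` and the `y`-mean of `Rʲ` (the MIXED-CENTRE
functionals), the Bernstein expansion is (`chain_bernstein_identity`, a ring identity in the
fourteen moments)

  `T(ρ) = (1−ρ)³·U(0,0,0) + ρ(1−ρ)²·[U(1,0,0) + U(0,1,0) + U(0,0,1)]
          + ρ²(1−ρ)·[U(1,1,0) + U(1,0,1) + U(0,1,1)] + ρ³·U(1,1,1)`,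

so `T(ρ) ≥ 0` on `[0, 1]` as soon as the four Bernstein coefficients are nonnegative
(`chain_bernstein_nonneg`).  Of the eight mixed-centre functionals, SIX are kernel theorems:
`U(0,0,0)` and `U(1,1,1)` are the OR-tail pairs with entries `ent` and `ent ∪ ent'`, and
`U(0,0,1)`, `U(1,0,1)`, `U(0,1,1)` are the world-1 gate centred at two chain `R`-means
(`chain_world1_mixed_nonneg`).  Hence (`chain_functional_nonneg_of_bernstein`): the general
AND-switch chain holds at EVERY `ρ ∈ [0, 1]` under the two COIN-FREE hypotheses
`U(1,1,0) ≥ 0` (the coin-closed gate centred at the world-1 `R`-means) and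
`U(1,0,0) + U(0,1,0) ≥ 0`; for the PURE chain (`ent = ∅`, `G⁰ = R⁰ = ν·c`) the second is FKG
of `ν·c` (`U(1,0,0) = U(0,1,0) = Λ¹·D₀`), so the pure chain holds at every `ρ` whenever the
world-0 law `ν·c` centred at the world-1 `R`-means has nonnegative centred product
(`pureChain_functional_nonneg_of_world0Centred`) — in particular under the same-sign hypothesis
of §58, but also whenever `Cov₀ ≥ |εφ|` with anti-aligned world shifts.  Census (§62): the
single unproved Bernstein coefficient `b₂ = [U(1,1,0) + U(1,0,1) + U(0,1,1)]/3` is `≥ 0` in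
every exact check (real heads) and in 15,458 abstract (APC) instances; `U(1,1,0) < 0` in
25–60 % of the checks.
-/

namespace Summit.Ventures.PercRepro2.Coin

section BernsteinIdentity

variable {R : Type*} [CommRing R]

/-- **The Bernstein identity of the chain cubic.** `a0 a1 a2` the mass and marker moments of the
coin-closed `R`-law `R⁰`, `b0 b1 b2` those of the coin-open `R`-law `R¹`, `e0 e1 e2 e12` the mass,
marker and joint moments of the coin-closed gate `G⁰`, `g0 g1 g2 g12` those of the coin-open gate
`G¹`; the left side is the cleared functional of the mixtures `(1−ρ)R⁰ + ρR¹` and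
`(1−ρ)G⁰ + ρG¹`, the right side its Bernstein expansion in the eight mixed-centre functionals. -/
theorem chain_bernstein_identity (a0 a1 a2 b0 b1 b2 e0 e1 e2 e12 g0 g1 g2 g12 ρ : R) :
    ((1 - ρ) * a0 + ρ * b0) ^ 2 * ((1 - ρ) * e12 + ρ * g12)
      - ((1 - ρ) * a0 + ρ * b0) * ((1 - ρ) * a1 + ρ * b1) * ((1 - ρ) * e2 + ρ * g2)
      - ((1 - ρ) * a0 + ρ * b0) * ((1 - ρ) * a2 + ρ * b2) * ((1 - ρ) * e1 + ρ * g1)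
      + ((1 - ρ) * a1 + ρ * b1) * ((1 - ρ) * a2 + ρ * b2) * ((1 - ρ) * e0 + ρ * g0) =
    (1 - ρ) ^ 3 * (a0 * a0 * e12 - a0 * a2 * e1 - a0 * a1 * e2 + a1 * a2 * e0)
      + ρ * (1 - ρ) ^ 2 *
        ((b0 * a0 * e12 - b0 * a2 * e1 - a0 * b1 * e2 + b1 * a2 * e0)
          + (a0 * b0 * e12 - a0 * b2 * e1 - b0 * a1 * e2 + a1 * b2 * e0)
          + (a0 * a0 * g12 - a0 * a2 * g1 - a0 * a1 * g2 + a1 * a2 * g0))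
      + ρ ^ 2 * (1 - ρ) *
        ((b0 * b0 * e12 - b0 * b2 * e1 - b0 * b1 * e2 + b1 * b2 * e0)
          + (b0 * a0 * g12 - b0 * a2 * g1 - a0 * b1 * g2 + b1 * a2 * g0)
          + (a0 * b0 * g12 - a0 * b2 * g1 - b0 * a1 * g2 + a1 * b2 * g0))
      + ρ ^ 3 * (b0 * b0 * g12 - b0 * b2 * g1 - b0 * b1 * g2 + b1 * b2 * g0) := by
  ring

end BernsteinIdentity

section BernsteinNonneg

variable {R : Type*} [Field R] [LinearOrder R] [IsStrictOrderedRing R]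

/-- **Bernstein positivity**: the chain cubic is nonnegative on `[0, 1]` when its four Bernstein
coefficients are. -/
theorem chain_bernstein_nonneg (a0 a1 a2 b0 b1 b2 e0 e1 e2 e12 g0 g1 g2 g12 ρ : R)
    (hρ0 : 0 ≤ ρ) (hρ1 : ρ ≤ 1)
    (h0 : 0 ≤ a0 * a0 * e12 - a0 * a2 * e1 - a0 * a1 * e2 + a1 * a2 * e0)
    (h1 : 0 ≤ (b0 * a0 * e12 - b0 * a2 * e1 - a0 * b1 * e2 + b1 * a2 * e0)
          + (a0 * b0 * e12 - a0 * b2 * e1 - b0 * a1 * e2 + a1 * b2 * e0)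
          + (a0 * a0 * g12 - a0 * a2 * g1 - a0 * a1 * g2 + a1 * a2 * g0))
    (h2 : 0 ≤ (b0 * b0 * e12 - b0 * b2 * e1 - b0 * b1 * e2 + b1 * b2 * e0)
          + (b0 * a0 * g12 - b0 * a2 * g1 - a0 * b1 * g2 + b1 * a2 * g0)
          + (a0 * b0 * g12 - a0 * b2 * g1 - b0 * a1 * g2 + a1 * b2 * g0))
    (h3 : 0 ≤ b0 * b0 * g12 - b0 * b2 * g1 - b0 * b1 * g2 + b1 * b2 * g0) :
    0 ≤ ((1 - ρ) * a0 + ρ * b0) ^ 2 * ((1 - ρ) * e12 + ρ * g12)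
      - ((1 - ρ) * a0 + ρ * b0) * ((1 - ρ) * a1 + ρ * b1) * ((1 - ρ) * e2 + ρ * g2)
      - ((1 - ρ) * a0 + ρ * b0) * ((1 - ρ) * a2 + ρ * b2) * ((1 - ρ) * e1 + ρ * g1)
      + ((1 - ρ) * a1 + ρ * b1) * ((1 - ρ) * a2 + ρ * b2) * ((1 - ρ) * e0 + ρ * g0) := by
  rw [chain_bernstein_identity]
  have hσ : 0 ≤ 1 - ρ := by linarith
  have t0 := mul_nonneg (pow_nonneg hσ 3) h0
  have t1 := mul_nonneg (mul_nonneg hρ0 (pow_nonneg hσ 2)) h1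
  have t2 := mul_nonneg (mul_nonneg (pow_nonneg hρ0 2) hσ) h2
  have t3 := mul_nonneg (pow_nonneg hρ0 3) h3
  linarith

end BernsteinNonneg

section BernsteinChain

variable {V : Type*} [DecidableEq V] {R : Type*} [Field R] [LinearOrder R] [IsStrictOrderedRing R]

omit [LinearOrder R] [IsStrictOrderedRing R] in
/-- The coin-closed chain value is the world-1 value of the chain WITHOUT the second entry set:
`chainMix ent ent' 0 c d = chainMix ent ∅ 1 c d`. -/
lemma chainMix_zero_as_one_empty (ent ent' : Finset V) (c d : Finset V → R) (W : Finset V) :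
    chainMix ent ent' 0 c d W = chainMix ent ∅ 1 c d W := by
  unfold chainMix chainTheta
  by_cases h0 : ∃ r ∈ ent, r ∈ W
  · simp [h0]
  · by_cases h1 : ∃ r ∈ ent', r ∈ W
    · simp [h0, h1]
    · simp [h0, h1]

/-- **THE GENERAL AND-SWITCH CHAIN AT EVERY COIN PROBABILITY FROM TWO COIN-FREE INEQUALITIES.**
`R⁰ = ν·chainMix ent ent' 0 c d`, `R¹ = ν·chainMix ent ent' 1 c d`, `G⁰ = ν·chainMix ent ent' 0 c d'`,
`G¹ = ν·chainMix ent ent' 1 c d'`; hypotheses of `chain_world1_nonneg`, nonnegative increasing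
markers, and the two coin-free inequalities `hU110` (the coin-closed gate `G⁰` centred at the
world-1 `R`-means has nonnegative cleared functional) and `hU100` (the sum of the two mixed-centre
functionals of `G⁰` with one centre from each world is nonnegative).  Then the chain functional
at every `ρ ∈ [0, 1]` is nonnegative. -/
theorem chain_functional_nonneg_of_bernstein (U ent ent' : Finset V) (ν c d d' : Finset V → R)
    (ρ : R) (hρ0 : 0 ≤ ρ) (hρ1 : ρ ≤ 1) (hν0 : ∀ W, 0 ≤ ν W)
    (hν : ∀ s ⊆ U, ∀ t ⊆ U, ν s * ν t ≤ ν (s ∩ t) * ν (s ∪ t))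
    (hc0 : ∀ W, 0 ≤ c W) (hd0 : ∀ W, 0 ≤ d W) (hd'0 : ∀ W, 0 ≤ d' W)
    (hdc : ∀ W, d W ≤ c W) (hd'c : ∀ W, d' W ≤ c W)
    (hcc : ∀ s t, c s * c t ≤ c (s ∩ t) * c (s ∪ t))
    (hdd : ∀ s t, d s * d t ≤ d (s ∩ t) * d (s ∪ t))
    (hd'd' : ∀ s t, d' s * d' t ≤ d' (s ∩ t) * d' (s ∪ t))
    (hcd : ∀ s t, c s * d t ≤ c (s ∩ t) * d (s ∪ t))
    (hcd' : ∀ s t, c s * d' t ≤ c (s ∩ t) * d' (s ∪ t))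
    (hdd' : ∀ s t, d s * d' t ≤ d (s ∩ t) * d' (s ∪ t))
    (hratio : ∀ s t, s ⊆ t → d s * c t ≤ c s * d t)
    (hratio' : ∀ s t, s ⊆ t → d' s * c t ≤ c s * d' t)
    (x y : Finset V → R) (hx0 : ∀ W, 0 ≤ x W) (hy0 : ∀ W, 0 ≤ y W)
    (hxm : ∀ s t, x s ≤ x (s ∪ t)) (hym : ∀ s t, y s ≤ y (s ∪ t))
    (hU110 : 0 ≤ (∑ W ∈ U.powerset, ν W * chainMix ent ent' 1 c d W) *
          (∑ W ∈ U.powerset, ν W * chainMix ent ent' 1 c d W) *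
          (∑ W ∈ U.powerset, ν W * chainMix ent ent' 0 c d' W * (x W * y W))
        - (∑ W ∈ U.powerset, ν W * chainMix ent ent' 1 c d W) *
          (∑ W ∈ U.powerset, ν W * chainMix ent ent' 1 c d W * y W) *
          (∑ W ∈ U.powerset, ν W * chainMix ent ent' 0 c d' W * x W)
        - (∑ W ∈ U.powerset, ν W * chainMix ent ent' 1 c d W) *
          (∑ W ∈ U.powerset, ν W * chainMix ent ent' 1 c d W * x W) *
          (∑ W ∈ U.powerset, ν W * chainMix ent ent' 0 c d' W * y W)
        + (∑ W ∈ U.powerset, ν W * chainMix ent ent' 1 c d W * x W) *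
          (∑ W ∈ U.powerset, ν W * chainMix ent ent' 1 c d W * y W) *
          (∑ W ∈ U.powerset, ν W * chainMix ent ent' 0 c d' W))
    (hU100 : 0 ≤ ((∑ W ∈ U.powerset, ν W * chainMix ent ent' 1 c d W) *
          (∑ W ∈ U.powerset, ν W * chainMix ent ent' 0 c d W) *
          (∑ W ∈ U.powerset, ν W * chainMix ent ent' 0 c d' W * (x W * y W))
        - (∑ W ∈ U.powerset, ν W * chainMix ent ent' 1 c d W) *
          (∑ W ∈ U.powerset, ν W * chainMix ent ent' 0 c d W * y W) *
          (∑ W ∈ U.powerset, ν W * chainMix ent ent' 0 c d' W * x W)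
        - (∑ W ∈ U.powerset, ν W * chainMix ent ent' 0 c d W) *
          (∑ W ∈ U.powerset, ν W * chainMix ent ent' 1 c d W * x W) *
          (∑ W ∈ U.powerset, ν W * chainMix ent ent' 0 c d' W * y W)
        + (∑ W ∈ U.powerset, ν W * chainMix ent ent' 1 c d W * x W) *
          (∑ W ∈ U.powerset, ν W * chainMix ent ent' 0 c d W * y W) *
          (∑ W ∈ U.powerset, ν W * chainMix ent ent' 0 c d' W))
        + ((∑ W ∈ U.powerset, ν W * chainMix ent ent' 0 c d W) *
          (∑ W ∈ U.powerset, ν W * chainMix ent ent' 1 c d W) *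
          (∑ W ∈ U.powerset, ν W * chainMix ent ent' 0 c d' W * (x W * y W))
        - (∑ W ∈ U.powerset, ν W * chainMix ent ent' 0 c d W) *
          (∑ W ∈ U.powerset, ν W * chainMix ent ent' 1 c d W * y W) *
          (∑ W ∈ U.powerset, ν W * chainMix ent ent' 0 c d' W * x W)
        - (∑ W ∈ U.powerset, ν W * chainMix ent ent' 1 c d W) *
          (∑ W ∈ U.powerset, ν W * chainMix ent ent' 0 c d W * x W) *
          (∑ W ∈ U.powerset, ν W * chainMix ent ent' 0 c d' W * y W)
        + (∑ W ∈ U.powerset, ν W * chainMix ent ent' 0 c d W * x W) *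
          (∑ W ∈ U.powerset, ν W * chainMix ent ent' 1 c d W * y W) *
          (∑ W ∈ U.powerset, ν W * chainMix ent ent' 0 c d' W))) :
    0 ≤ (∑ W ∈ U.powerset, ν W * chainMix ent ent' ρ c d W) ^ 2 *
          (∑ W ∈ U.powerset, ν W * chainMix ent ent' ρ c d' W * (x W * y W))
        - (∑ W ∈ U.powerset, ν W * chainMix ent ent' ρ c d W) *
          (∑ W ∈ U.powerset, ν W * chainMix ent ent' ρ c d W * x W) *
          (∑ W ∈ U.powerset, ν W * chainMix ent ent' ρ c d' W * y W)
        - (∑ W ∈ U.powerset, ν W * chainMix ent ent' ρ c d W) *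
          (∑ W ∈ U.powerset, ν W * chainMix ent ent' ρ c d W * y W) *
          (∑ W ∈ U.powerset, ν W * chainMix ent ent' ρ c d' W * x W)
        + (∑ W ∈ U.powerset, ν W * chainMix ent ent' ρ c d W * x W) *
          (∑ W ∈ U.powerset, ν W * chainMix ent ent' ρ c d W * y W) *
          (∑ W ∈ U.powerset, ν W * chainMix ent ent' ρ c d' W) := by
  -- the seven sums at `ρ` are affine in `ρ` (`chainMix_affine`)
  have hR : ∀ W, ν W * chainMix ent ent' ρ c d W =
      (1 - ρ) * (ν W * chainMix ent ent' 0 c d W) + ρ * (ν W * chainMix ent ent' 1 c d W) := by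
    intro W; rw [chainMix_affine ent ent' ρ c d W]; ring
  have hG : ∀ W, ν W * chainMix ent ent' ρ c d' W =
      (1 - ρ) * (ν W * chainMix ent ent' 0 c d' W) + ρ * (ν W * chainMix ent ent' 1 c d' W) := by
    intro W; rw [chainMix_affine ent ent' ρ c d' W]; ring
  have s0 : ∑ W ∈ U.powerset, ν W * chainMix ent ent' ρ c d W =
      (1 - ρ) * ∑ W ∈ U.powerset, ν W * chainMix ent ent' 0 c d W +
        ρ * ∑ W ∈ U.powerset, ν W * chainMix ent ent' 1 c d W := by
    rw [Finset.mul_sum, Finset.mul_sum, ← Finset.sum_add_distrib]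
    exact Finset.sum_congr rfl fun W _ => hR W
  have s1 : ∑ W ∈ U.powerset, ν W * chainMix ent ent' ρ c d W * x W =
      (1 - ρ) * ∑ W ∈ U.powerset, ν W * chainMix ent ent' 0 c d W * x W +
        ρ * ∑ W ∈ U.powerset, ν W * chainMix ent ent' 1 c d W * x W := by
    rw [Finset.mul_sum, Finset.mul_sum, ← Finset.sum_add_distrib]
    exact Finset.sum_congr rfl fun W _ => by rw [hR W]; ring
  have s2 : ∑ W ∈ U.powerset, ν W * chainMix ent ent' ρ c d W * y W =
      (1 - ρ) * ∑ W ∈ U.powerset, ν W * chainMix ent ent' 0 c d W * y W +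
        ρ * ∑ W ∈ U.powerset, ν W * chainMix ent ent' 1 c d W * y W := by
    rw [Finset.mul_sum, Finset.mul_sum, ← Finset.sum_add_distrib]
    exact Finset.sum_congr rfl fun W _ => by rw [hR W]; ring
  have g0 : ∑ W ∈ U.powerset, ν W * chainMix ent ent' ρ c d' W =
      (1 - ρ) * ∑ W ∈ U.powerset, ν W * chainMix ent ent' 0 c d' W +
        ρ * ∑ W ∈ U.powerset, ν W * chainMix ent ent' 1 c d' W := by
    rw [Finset.mul_sum, Finset.mul_sum, ← Finset.sum_add_distrib]
    exact Finset.sum_congr rfl fun W _ => hG W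
  have g1 : ∑ W ∈ U.powerset, ν W * chainMix ent ent' ρ c d' W * x W =
      (1 - ρ) * ∑ W ∈ U.powerset, ν W * chainMix ent ent' 0 c d' W * x W +
        ρ * ∑ W ∈ U.powerset, ν W * chainMix ent ent' 1 c d' W * x W := by
    rw [Finset.mul_sum, Finset.mul_sum, ← Finset.sum_add_distrib]
    exact Finset.sum_congr rfl fun W _ => by rw [hG W]; ring
  have g2 : ∑ W ∈ U.powerset, ν W * chainMix ent ent' ρ c d' W * y W =
      (1 - ρ) * ∑ W ∈ U.powerset, ν W * chainMix ent ent' 0 c d' W * y W +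
        ρ * ∑ W ∈ U.powerset, ν W * chainMix ent ent' 1 c d' W * y W := by
    rw [Finset.mul_sum, Finset.mul_sum, ← Finset.sum_add_distrib]
    exact Finset.sum_congr rfl fun W _ => by rw [hG W]; ring
  have g12 : ∑ W ∈ U.powerset, ν W * chainMix ent ent' ρ c d' W * (x W * y W) =
      (1 - ρ) * ∑ W ∈ U.powerset, ν W * chainMix ent ent' 0 c d' W * (x W * y W) +
        ρ * ∑ W ∈ U.powerset, ν W * chainMix ent ent' 1 c d' W * (x W * y W) := by
    rw [Finset.mul_sum, Finset.mul_sum, ← Finset.sum_add_distrib]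
    exact Finset.sum_congr rfl fun W _ => by rw [hG W]; ring
  rw [s0, s1, s2, g0, g1, g2, g12]
  -- the six kernel mixed-centre functionals
  have hU111 := chain_world1_mixed_nonneg U ent ent' ν c d d' 1 1 zero_le_one le_rfl zero_le_one
    le_rfl hν0 hν hc0 hd0 hd'0 hdc hd'c hcc hdd hd'd' hcd hcd' hdd' hratio hratio' x y hx0 hy0 hxm hym
  have hU001 := chain_world1_mixed_nonneg U ent ent' ν c d d' 0 0 le_rfl zero_le_one le_rfl
    zero_le_one hν0 hν hc0 hd0 hd'0 hdc hd'c hcc hdd hd'd' hcd hcd' hdd' hratio hratio' x y hx0 hy0 hxm hym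
  have hU101 := chain_world1_mixed_nonneg U ent ent' ν c d d' 1 0 zero_le_one le_rfl le_rfl
    zero_le_one hν0 hν hc0 hd0 hd'0 hdc hd'c hcc hdd hd'd' hcd hcd' hdd' hratio hratio' x y hx0 hy0 hxm hym
  have hU011 := chain_world1_mixed_nonneg U ent ent' ν c d d' 0 1 le_rfl zero_le_one zero_le_one
    le_rfl hν0 hν hc0 hd0 hd'0 hdc hd'c hcc hdd hd'd' hcd hcd' hdd' hratio hratio' x y hx0 hy0 hxm hym
  -- the coin-closed pair `(R⁰, G⁰)` is the OR-tail pair with entries `ent`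
  have hU000 := chain_world1_mixed_nonneg U ent ∅ ν c d d' 1 1 zero_le_one le_rfl zero_le_one
    le_rfl hν0 hν hc0 hd0 hd'0 hdc hd'c hcc hdd hd'd' hcd hcd' hdd' hratio hratio' x y hx0 hy0 hxm hym
  simp only [← chainMix_zero_as_one_empty ent ent'] at hU000
  exact chain_bernstein_nonneg _ _ _ _ _ _ _ _ _ _ _ _ _ _ ρ hρ0 hρ1 hU000
    (add_nonneg hU100 hU001) (add_nonneg (add_nonneg hU110 hU101) hU011) hU111

end BernsteinChain

end Summit.Ventures.PercRepro2.Coin
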